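import Mathlib
import HarnessLib
import Summits.CriticalPhenomena.PercolationContinuityZ3.Theorems.PercNearOneGluingNoHeavyQuantFarDecChain

/-!
# QUANT lane R8, front "FAR beyond trees", layer one — block-locality for ARBITRARY pendant cores, file 1:
# the Φ-FORM of domination and the STEP CHAIN (pure real algebra)

builds on p205010 (kernel theorem, internal audit signed; external expert review pending)

Support file (`--supports stmt-CriticalPhenomena-4575`), seat `prim-quant-p1` (gen 23); memo
`run/shared/lean/prim/quant/prim-quant-p1-g23/FOR-LEAD-CORESTEP.md` §1–§2.  Pure real algebra; standard axioms; no sorries; no definitions.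

The block-transfer theorem (`Block.real_card_le_one_le_of_dominates`, p1 g19) and its hub-family form (`Block.farLayerOne_hubFamily_law`,
p1 g22) reduce FAR(1) block-locality of an arbitrary pendant 2-connected core to a DOMINATION `S ≽ (S', q)`:
`∃ λ ∈ [0,1], λh' + (1−λ)q ≤ h ∧ λt' + (1−λ)q ≤ t` between the internal numbers `S = (h, t) = (P(X ≥ 1), P(X ≥ 2))` of the block and
`S' = (h', t')` of a comparison block.  This file records the observation (memo §1) that domination is governed by ONE MONOTONE FUNCTIONAL
`Φ_q(X) = P(X = 1)/(P(X ≥ 1) − q)`: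

* `Block.phi_F_eq` — the first-coordinate-tight quantity `F = (t − t')(h' − q) − (h' − h)(q − t')` of `Block.dominates_of_tight` (p1 g20) IS
  `(h − q)·P(X' = 1) − (h' − q)·P(X = 1)` (with `P(X = 1) = h − t`);
* `Block.dominates_of_phi` — `q ≤ h ≤ h'`, `q < h'` and `(h' − q)(h − t) ≤ (h − q)(h' − t')` give `S ≽ (S', q)`;
* `Block.dominates_of_stepAB` — THE ONE-STEP PACKAGE: monotonicity `h ≤ h'`, **(A)** `t' < q ⟹ (h' − q)(h − t) ≤ (h − q)(h' − t')`,
  **(B)** `q ≤ t' ⟹ q ≤ t` (plus the degenerate tie-break `t' < q ∧ h' = q ⟹ t' ≤ t`) give `S ≽ (S', q)` — regime `t' ≥ q` is the exit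
  (`Block.dominates_of_exit`), regime `t' < q` is `dominates_of_phi`;
* `Block.dominates_chain` — along a chain `S₀, S₁, …, S_k` (one anchor decoupled at a time) the per-step hypotheses (M)(A)(B)(T) compose
  (`Block.dominates_trans`, p1 g20) to `S₀ ≽ (S_k, q)`.
So the whole law-level content of block-locality for a general core is the pair of ONE-VERTEX inequalities (A_v), (B_v) of memo §2
(numerically exact-tested on every anchor of every core with ≤ 7 vertices, 0 failures; kit j178365); file 2 (`…CoreStepLaw`) instantiates the
chain with the explicit law-level numbers of a core reach law `ρ` and delivers the hypothesis `hdom` of `Block.farLayerOne_hubFamily_law`.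
[this work]
-/

namespace Summit.CriticalPhenomena.PercolationContinuityZ3.Theorems

namespace Quant

namespace Block

/-- **The Φ-form of the tight criterion**: `(h − q)·P(X' = 1) − (h' − q)·P(X = 1) = (t − t')(h' − q) − (h' − h)(q − t')`
(`P(X = 1) = h − t`, `P(X' = 1) = h' − t'`). [this work] -/
theorem phi_F_eq (q hS tS hP tP : ℝ) :
    (hS - q) * (hP - tP) - (hP - q) * (hS - tS) = (tS - tP) * (hP - q) - (hP - hS) * (q - tP) := by
  ring

/-- **Domination from the Φ-inequality**: if `q ≤ h ≤ h'`, `q < h'` and `(h' − q)·P(X = 1) ≤ (h − q)·P(X' = 1)` then `S ≽ (S', q)`.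
[this work] -/
theorem dominates_of_phi (q hS tS hP tP : ℝ) (hq : q ≤ hS) (hSP : hS ≤ hP) (hqP : q < hP)
    (hA : (hP - q) * (hS - tS) ≤ (hS - q) * (hP - tP)) :
    ∃ l : ℝ, 0 ≤ l ∧ l ≤ 1 ∧ l * hP + (1 - l) * q ≤ hS ∧ l * tP + (1 - l) * q ≤ tS :=
  dominates_of_tight q hS tS hP tP hq hSP hqP (by rw [← phi_F_eq]; linarith)

/-- **The one-step package.**  For a step `S = (h, t) ↦ S' = (h', t')` (one anchor decoupled) with `q ≤ h ≤ h'`: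
(A) `t' < q ⟹ (h' − q)(h − t) ≤ (h − q)(h' − t')`, (B) `q ≤ t' ⟹ q ≤ t`, and the tie-break (T) `t' < q ⟹ h' = q ⟹ t' ≤ t`
give `S ≽ (S', q)`. [this work] -/
theorem dominates_of_stepAB (q hS tS hP tP : ℝ) (hq : q ≤ hS) (hSP : hS ≤ hP)
    (hA : tP < q → (hP - q) * (hS - tS) ≤ (hS - q) * (hP - tP))
    (hB : q ≤ tP → q ≤ tS) (hT : tP < q → hP = q → tP ≤ tS) :
    ∃ l : ℝ, 0 ≤ l ∧ l ≤ 1 ∧ l * hP + (1 - l) * q ≤ hS ∧ l * tP + (1 - l) * q ≤ tS := by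
  by_cases h1 : q ≤ tP
  · exact dominates_of_exit q hS tS hP tP hq (hB h1)
  · have h1' : tP < q := lt_of_not_ge h1
    by_cases h2 : q < hP
    · exact dominates_of_phi q hS tS hP tP hq hSP h2 (hA h1')
    · have hPq : hP = q := le_antisymm (le_of_not_gt h2) (le_trans hq hSP)
      exact dominates_of_le q hS tS hP tP (by rw [hPq]; exact hq) (hT h1' hPq)

/-- **The step chain.**  Numbers `S_i = (h i, t i)`, `i = 0, …, k` (one more anchor decoupled at each step), an exit value `q ≤ h 0`, and for
every step `i < k`: (M) `h i ≤ h (i+1)`, (A) `t (i+1) < q ⟹ (h (i+1) − q)(h i − t i) ≤ (h i − q)(h (i+1) − t (i+1))`, (B) `q ≤ t (i+1) ⟹ q ≤ t i`,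
(T) `t (i+1) < q ⟹ h (i+1) = q ⟹ t (i+1) ≤ t i`.  Then `S_0 ≽ (S_k, q)`. [this work] -/
theorem dominates_chain (q : ℝ) (h t : ℕ → ℝ) (k : ℕ) (hq : q ≤ h 0)
    (hM : ∀ i, i < k → h i ≤ h (i + 1))
    (hA : ∀ i, i < k → t (i + 1) < q → (h (i + 1) - q) * (h i - t i) ≤ (h i - q) * (h (i + 1) - t (i + 1)))
    (hB : ∀ i, i < k → q ≤ t (i + 1) → q ≤ t i)
    (hT : ∀ i, i < k → t (i + 1) < q → h (i + 1) = q → t (i + 1) ≤ t i) :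
    ∃ l : ℝ, 0 ≤ l ∧ l ≤ 1 ∧ l * h k + (1 - l) * q ≤ h 0 ∧ l * t k + (1 - l) * q ≤ t 0 := by
  induction k with
  | zero => exact dominates_of_le q (h 0) (t 0) (h 0) (t 0) le_rfl le_rfl
  | succ k ih =>
    have hqk : ∀ i, i ≤ k → q ≤ h i := by
      intro i hi
      induction i with
      | zero => exact hq
      | succ i ih' => exact le_trans (ih' (by omega)) (hM i (by omega))
    have H₁ := ih (fun i hi => hM i (by omega)) (fun i hi => hA i (by omega)) (fun i hi => hB i (by omega)) (fun i hi => hT i (by omega))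
    have H₂ := dominates_of_stepAB q (h k) (t k) (h (k + 1)) (t (k + 1)) (hqk k le_rfl) (hM k (by omega)) (hA k (by omega))
      (hB k (by omega)) (hT k (by omega))
    exact dominates_trans q _ _ _ _ _ _ H₁ H₂

/-- **The (U)-form along a chain**: under the hypotheses of `Block.dominates_chain`, `min (t k) q ≤ t 0` and `min (h k) q ≤ h 0`. [this work] -/
theorem chain_ge_min (q : ℝ) (h t : ℕ → ℝ) (k : ℕ) (hq : q ≤ h 0)
    (hM : ∀ i, i < k → h i ≤ h (i + 1))
    (hA : ∀ i, i < k → t (i + 1) < q → (h (i + 1) - q) * (h i - t i) ≤ (h i - q) * (h (i + 1) - t (i + 1)))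
    (hB : ∀ i, i < k → q ≤ t (i + 1) → q ≤ t i)
    (hT : ∀ i, i < k → t (i + 1) < q → h (i + 1) = q → t (i + 1) ≤ t i) :
    min (t k) q ≤ t 0 ∧ min (h k) q ≤ h 0 := by
  obtain ⟨l, hl0, hl1, h1, h2⟩ := dominates_chain q h t k hq hM hA hB hT
  constructor
  · have a := min_le_left (t k) q
    have b := min_le_right (t k) q
    nlinarith [mul_le_mul_of_nonneg_left a hl0, mul_le_mul_of_nonneg_left b (sub_nonneg.mpr hl1)]
  · have a := min_le_left (h k) q
    have b := min_le_right (h k) q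
    nlinarith [mul_le_mul_of_nonneg_left a hl0, mul_le_mul_of_nonneg_left b (sub_nonneg.mpr hl1)]

/-- **Φ-monotonicity along a chain** (the transitive form, without exit bookkeeping): if every step satisfies (A) unconditionally and the
numbers stay above `q` (`q < h i`, `P(X_i = 1) ≥ 0`), then `(h k − q)·P(X_0 = 1) ≤ (h 0 − q)·P(X_k = 1)`. [this work] -/
theorem phi_chain (q : ℝ) (h t : ℕ → ℝ) (k : ℕ) (hpos : ∀ i, i ≤ k → q < h i) (hP1 : ∀ i, i ≤ k → t i ≤ h i)
    (hA : ∀ i, i < k → (h (i + 1) - q) * (h i - t i) ≤ (h i - q) * (h (i + 1) - t (i + 1))) :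
    (h k - q) * (h 0 - t 0) ≤ (h 0 - q) * (h k - t k) := by
  induction k with
  | zero => exact le_rfl
  | succ k ih =>
    have H₁ := ih (fun i hi => hpos i (by omega)) (fun i hi => hP1 i (by omega)) (fun i hi => hA i (by omega))
    have H₂ := hA k (by omega)
    have h0 : 0 < h 0 - q := by linarith [hpos 0 (by omega)]
    have hk : 0 < h k - q := by linarith [hpos k (by omega)]
    have hk1 : 0 ≤ h (k + 1) - q := by linarith [hpos (k + 1) le_rfl]
    -- (h(k+1) − q)(h0 − t0)(hk − q) ≤ (h(k+1) − q)(h0 − q)(hk − tk) ≤ (h0 − q)(hk − q)(h(k+1) − t(k+1))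
    have e1 : (h (k + 1) - q) * (h 0 - t 0) * (h k - q) ≤ (h (k + 1) - q) * ((h 0 - q) * (h k - t k)) := by
      have := mul_le_mul_of_nonneg_left H₁ hk1
      linarith [this]
    have e2 : (h 0 - q) * ((h (k + 1) - q) * (h k - t k)) ≤ (h 0 - q) * ((h k - q) * (h (k + 1) - t (k + 1))) :=
      mul_le_mul_of_nonneg_left H₂ h0.le
    have e3 : (h (k + 1) - q) * (h 0 - t 0) * (h k - q) ≤ (h 0 - q) * (h (k + 1) - t (k + 1)) * (h k - q) := by nlinarith [e1, e2]
    exact le_of_mul_le_mul_right e3 hk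

end Block

end Quant

end Summit.CriticalPhenomena.PercolationContinuityZ3.Theorems
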